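import Literature.MathematicalPhysics.QuantumFieldTheory.Balaban1983to89.B9Thm37GlueLevelSumComm

/-!
# `Balaban1983to89.B9Thm37GlueLevelSumOsc` — the oscillation letters ω_l of the multi-level averaging line DISCHARGED for the
# k-fold comb tower from a PER-BOND bound of h_□: comb paths are bond chains, two sites of one level-l tower block are joined by
# ≤ 2·Σ_{j<l} D_j bonds, hence |h_□(x) − h_□(x′)| ≤ 2(Σ_{j<l} D_j)·θ; and the five Q-binders of the `B9Thm37Glue` lineage for the
# tower's averaging part with these EXPLICIT letters (companion of `B9Thm37GlueLevelSumComm`; cell `pub-ymgap`, Track A node N06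
# [B9] second -b seat dag-n19-b, dag-lead REBALANCE-12; count-neutral MODEL bookkeeping)

References (bib keys): [B9] = `Balaban1985BackgroundPropagators` — T. Bałaban, *Propagators for lattice gauge theories in a
background field*, Commun. Math. Phys. 99 (1985) 389–434; [4] = `Balaban1984PropagatorsII` — T. Bałaban, *Propagators and
renormalization transformations for lattice gauge theories. II*, Commun. Math. Phys. 96 (1984) 223–250; [3] =
`Balaban1984PropagatorsI` (only NAMED: (1.118), the partition of unity, through `B9Thm37GluePU`).

THE PRINTED LOCI (only NAMED; certified in the headers of `B9Thm37GlueQ`, `B9Thm37GlueSz`, `B9Thm37GluePU`, `B9Thm37GlueTorusCov`):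
[B9] (3.88)–(3.89) p. 409 (the averaging term of K(h_□) and its size «O(M^{−1})»), (3.19) p. 393 (the contours Γ_{y,x} of the block
averages — the lineage's COMBS `B9Thm37GlueTorusCov.Comb`), [4] (2.36)∕(1.118) (h_□ varies on the cube scale).  NOTHING printed is
asserted.

THE POINT.  `B9Thm37GlueLevelSumComm.commData_towerLevelSum` leaves the within-level-block oscillation letters `o_{l,□}`, `ω_l` of h_□
as HYPOTHESES.  Here they are DERIVED for the tower from the primitive per-bond size θ of h_□ (the letter of `B9Thm37GlueSz`∕`…PU`;
on the torus θ = 4d∕M₀, `B9Thm37GluePU.hθ_torus`): §5 `linked_append`∕`linked_reverse`∕`linked_base` (comb paths are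
`B9Thm37GlueQ.Linked` chains), `tower_linked`∕`tower_linked_pair` (≤ Σ_{j<l} D_j resp. 2Σ_{j<l} D_j bonds), **`tower_osc_of_bondBound`**
(|h(x) − h(x′)| ≤ 2(Σ_{j<l} D_j)θ on one level-l block); §6 **`commData_towerLevelSum_of_bondBound`**: the five Q-binders for
[M_{h_□}, Σ_{l≤k} a_lG_lᵀG_l] with `ω_l = 2(Σ_{j<l} D_j)θ`, `κ_Q = Σ_l ω_l k_l`, localisation from «h_□ ≡ 0 on geometry blocks outside
S′_□».  With D_j = d(M_j − 1) (`B9Thm37GlueTorusCovPoinc.tdepth_le`) and θ = 4d∕M₀ this is print's O(M^{−1}) per level in the model's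
letters.

HONEST SCOPE.  Component MODEL of the lineage; the size letters `k_l` (print O(a_l)) stay hypotheses; nothing of (3.89)'s D-part, of
Corollary 3.6, of Σ R′ⁿ or of Theorems 3.1–3.3∕3.7 is touched.  Value = MODEL kernel bookkeeping, NOT summit progress; NOT continuum,
NOT Clay, NOT a claim about print.
-/

namespace Literature.MathematicalPhysics.QuantumFieldTheory.Balaban1983to89.B9Thm37GlueLevelSumOsc

open Literature.MathematicalPhysics.QuantumFieldTheory.Balaban1983to89
open Finset B6RandomWalk B9Thm37Sum B9Thm34Ext B9Thm37GlueQ B9Thm37GlueTorusCov B9Thm37GlueTorusCovComp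
  B9Thm37GlueTorusCovLevels B9Thm37GlueTorusCovTower B9Thm37GlueTorusCovTowerPU B9Thm37GlueLevelSumComm

noncomputable section

/-! ## §5  The oscillation letters ω_l FOR THE TOWER from a per-bond bound: comb paths

Print's «O(M⁻¹)» for the averaging line: h_□ varies by O((ML^jη)^{−1}) per η-bond ([4] (1.118)∕(2.36); in the torus
model `B9Thm37GluePU.hθ_torus`: 4d∕M₀ per bond) and two sites of one block are joined by a bounded chain of bonds.  For the
k-fold comb tower the chain is EXPLICIT: x is joined to its level-(j+1) representative through K_j's comb path of the level-j
representative (`Comb.parent`∕`pbond`, `depth ≤ D_j` steps), so two sites of one level-l block are joined by ≤ 2·Σ_{j<l} D_j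
bonds and |h(x) − h(x′)| ≤ 2(Σ_{j<l} D_j)·θ.  Localisation: h_□ ≡ 0 on geometry blocks outside S′_□ ⇒ the oscillation
letter vanishes there.  (The chain notion is `B9Thm37GlueQ.Linked`.) -/

namespace Chains

variable {St Bd B : Type} {src tgt : Bd → St}

/-- Appending chains: `x —n→ c` and `c —m→ x′` give `x —(m+n)→ x′`. [folklore] -/
private theorem linked_append (E : Bd → Prop) : ∀ (n : ℕ) (x c x' : St) (m : ℕ),
    Linked src tgt E n x c → Linked src tgt E m c x' → Linked src tgt E (m + n) x x' := by
  intro n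
  induction n with
  | zero =>
    intro x c x' m h1 h2
    have hxc : x = c := h1
    rw [hxc]
    exact h2
  | succ n ih =>
    intro x c x' m h1 h2
    obtain ⟨b, hE, hb⟩ := h1
    rcases hb with ⟨hs, hl⟩ | ⟨ht, hl⟩
    · exact ⟨b, hE, Or.inl ⟨hs, ih _ _ _ _ hl h2⟩⟩
    · exact ⟨b, hE, Or.inr ⟨ht, ih _ _ _ _ hl h2⟩⟩

/-- One bond, either direction, is a chain of length one. [folklore] -/
private theorem linked_one_of_bond (E : Bd → Prop) {b : Bd} (hE : E b) :
    Linked src tgt E 1 (src b) (tgt b) ∧ Linked src tgt E 1 (tgt b) (src b) :=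
  ⟨⟨b, hE, Or.inl ⟨rfl, rfl⟩⟩, ⟨b, hE, Or.inr ⟨rfl, rfl⟩⟩⟩

/-- Reversing a chain. [folklore] -/
private theorem linked_reverse (E : Bd → Prop) : ∀ (m : ℕ) (x c : St), Linked src tgt E m x c → Linked src tgt E m c x := by
  intro m
  induction m with
  | zero =>
    intro x c h
    have hxc : x = c := h
    rw [hxc]
    rfl
  | succ m ih =>
    intro x c h
    obtain ⟨b, hE, hb⟩ := h
    rcases hb with ⟨hs, hl⟩ | ⟨ht, hl⟩
    · have h1 : Linked src tgt E 1 (tgt b) x := hs ▸ (linked_one_of_bond E hE).2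
      have h2 := linked_append E m c (tgt b) x 1 (ih _ _ hl) h1
      rwa [Nat.add_comm] at h2
    · have h1 : Linked src tgt E 1 (src b) x := ht ▸ (linked_one_of_bond E hE).1
      have h2 := linked_append E m c (src b) x 1 (ih _ _ hl) h1
      rwa [Nat.add_comm] at h2

/-- **A COMB PATH IS A CHAIN**: every site is joined to the base point of its comb block by `depth x` parent bonds.
[cite: Balaban1985BackgroundPropagators, (3.19) p.393] -/
theorem linked_base (K : Comb src tgt B) : ∀ (m : ℕ) (x : St), K.depth x = m →
    Linked src tgt (fun _ => True) m x (K.base (K.blk x)) := by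
  intro m
  induction m with
  | zero =>
    intro x hx
    exact K.eq_base x hx
  | succ m ih =>
    intro x hx
    have hne : K.depth x ≠ 0 := by omega
    have hpar : K.depth (K.parent x) = m := by have := K.depth_parent x hne; omega
    refine ⟨K.pbond x, trivial, Or.inr ⟨K.tgt_pbond x hne, ?_⟩⟩
    rw [K.src_pbond x hne, ← K.blk_parent x hne]
    exact ih _ hpar

end Chains

section TowerChains

open Chains

variable {St Bd Cp : Type} [Fintype Cp] [DecidableEq Cp] {src tgt : Bd → St} {Bs : ℕ → Type}
  (Ks : ∀ j, Comb src tgt (Bs j))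

/-- **EVERY SITE IS CHAINED TO ITS LEVEL-l REPRESENTATIVE** by at most `Σ_{j<l} D_j` bonds (combs of depth `≤ D_j`).
[cite: Balaban1985BackgroundPropagators, (3.19) p.393] -/
theorem tower_linked {D : ℕ → ℕ} (hD : ∀ j y, (Ks j).depth y ≤ D j) :
    ∀ (l : ℕ) (x : St), ∃ n, n ≤ ∑ j ∈ Finset.range l, D j ∧ Linked src tgt (fun _ => True) n x (towerBlk Ks l x) := by
  intro l
  induction l with
  | zero => exact fun x => ⟨0, le_rfl, rfl⟩
  | succ l ih =>
    intro x
    obtain ⟨n, hn, hl⟩ := ih x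
    have hstep := linked_base (Ks l) _ (towerBlk Ks l x) rfl
    refine ⟨(Ks l).depth (towerBlk Ks l x) + n, ?_, ?_⟩
    · rw [Finset.sum_range_succ]
      have := hD l (towerBlk Ks l x)
      omega
    · rw [towerBlk_succ]
      exact linked_append _ n x _ _ _ hl hstep

/-- **TWO SITES OF ONE LEVEL-l TOWER BLOCK ARE CHAINED** by at most `2·Σ_{j<l} D_j` bonds (both comb paths of (3.19) to the
common representative). [cite: Balaban1985BackgroundPropagators, (3.19) p.393] -/
theorem tower_linked_pair {D : ℕ → ℕ} (hD : ∀ j y, (Ks j).depth y ≤ D j) (l : ℕ) {x x' : St}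
    (h : towerBlk Ks l x = towerBlk Ks l x') :
    ∃ n, n ≤ 2 * ∑ j ∈ Finset.range l, D j ∧ Linked src tgt (fun _ => True) n x x' := by
  obtain ⟨n₁, hn₁, hl₁⟩ := tower_linked Ks hD l x
  obtain ⟨n₂, hn₂, hl₂⟩ := tower_linked Ks hD l x'
  rw [h] at hl₁
  exact ⟨n₂ + n₁, by omega, linked_append _ n₁ x _ x' n₂ hl₁ (linked_reverse _ n₂ x' _ hl₂)⟩

/-- **WITHIN-LEVEL-BLOCK OSCILLATION FROM A PER-BOND BOUND**: `|h(tgt b) − h(src b)| ≤ θ` on every bond ⇒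
`|h(x) − h(x′)| ≤ 2(Σ_{j<l} D_j)·θ` for `x, x′` in one level-l tower block — the «O(M⁻¹)» of (3.89) for the averaging line in
the model's letters (θ = 4d∕M₀ on the torus, `B9Thm37GluePU.hθ_torus`). [cite: Balaban1985BackgroundPropagators, (3.89) p.409] -/
theorem tower_osc_of_bondBound {D : ℕ → ℕ} (hD : ∀ j y, (Ks j).depth y ≤ D j) {h : St → ℝ} {θ : ℝ}
    (hθ0 : 0 ≤ θ) (hθ : ∀ b, |h (tgt b) - h (src b)| ≤ θ) (l : ℕ) {x x' : St}
    (hb : towerBlk Ks l x = towerBlk Ks l x') :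
    |h x - h x'| ≤ 2 * (∑ j ∈ Finset.range l, D j : ℕ) * θ := by
  obtain ⟨n, hn, hl⟩ := tower_linked_pair Ks hD l hb
  calc |h x - h x'| ≤ n * θ := abs_sub_le_of_linked src tgt _ h θ (fun b _ => hθ b) n x x' hl
    _ ≤ 2 * (∑ j ∈ Finset.range l, D j : ℕ) * θ := by
        have : (n : ℝ) ≤ ((2 * ∑ j ∈ Finset.range l, D j : ℕ) : ℝ) := by exact_mod_cast hn
        push_cast at this ⊢
        nlinarith

end TowerChains

/-! ## §6  The tower's five Q-binders with the oscillation letters DISCHARGED from a per-bond bound -/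

section TowerBond

open Chains

variable {g : B9.Geometry} [Fintype g.Site] [DecidableEq g.Site] {R : ℝ} {H : Prop}
  {St Bd Cp ι : Type} [Fintype St] [DecidableEq St] [Fintype Cp] [DecidableEq Cp] {src tgt : Bd → St}
  {Bs : ℕ → Type} [∀ j, DecidableEq (Bs j)] (Ks : ∀ j, Comb src tgt (Bs j))
  (Rm : Bd → Cp → Cp → ℝ)

/-- **THE Q-DATA FOR THE TOWER'S AVERAGING PART WITH ω_l = min-free EXPLICIT LETTERS**: as `commData_towerLevelSum`, but the
oscillation binder is DISCHARGED from (i) a per-bond bound `|h_□(tgt b) − h_□(src b)| ≤ θ` for every cube `□ = i` and every bond,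
(ii) comb depths `≤ D_j`, (iii) localisation: `h_□` vanishes identically on the geometry blocks outside `S′_□`.  The letters are
`o_{l,□}(b) = 1_{b∈S′_□}·2(Σ_{j<l} D_j)·θ`, `ω_l = 2(Σ_{j<l} D_j)·θ`, `κ_Q = Σ_{l≤k} ω_l·k_l` — on the torus model of [3] (1.118)
(`hSU`, θ = 4d∕M₀, D_j = d(M_j − 1)) this is O(M₀^{−1}) per level, print's «O(M^{−1})» of (3.89) for the second display line
of (3.88). [cite: Balaban1985BackgroundPropagators, (3.88)–(3.89) p.409 + (3.16)∕(3.19) p.393; Balaban1984PropagatorsII, (2.40)–(2.44) p.230] -/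
theorem commData_towerLevelSum_of_bondBound
    (hRm : ∀ b i j, ∑ k, Rm b k i * Rm b k j = if i = j then (1 : ℝ) else 0)
    (k : ℕ) (W : Fin (k + 1) → St → ℝ) (a : Fin (k + 1) → ℝ) (wb : Fin (k + 1) → ℝ) (n D : ℕ → ℕ)
    (blk : St × Cp → g.Site)
    (hnestTop : ∀ p q : St × Cp, towerBlk Ks k q.1 = towerBlk Ks k p.1 → blk q = blk p)
    (hW : ∀ l x, |W l x| ≤ wb l) (hn : ∀ j β, (univ.filter fun x => (Ks j).blk x = β).card ≤ n j)
    (hD : ∀ j y, (Ks j).depth y ≤ D j)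
    (ρ : ℝ) (hρ : ∀ b : g.Site, g.dist b b ≤ ρ) (kk : Fin (k + 1) → ℝ)
    (hk : ∀ l (b : g.Site), |a l| * (wb l ^ 2 * (Fintype.card Cp : ℝ) ^ 2 * towerN n l) * g.len b ^ 2 ≤ kk l)
    (hs : ι → St → ℝ) (S' : ι → Finset g.Site) {θ : ℝ} (hθ0 : 0 ≤ θ)
    (hθ : ∀ i b, |hs i (tgt b) - hs i (src b)| ≤ θ)
    (hzero : ∀ i (p : St × Cp), blk p ∉ S' i → hs i p.1 = 0) :
    (∀ i, HasMajorant (g := toB6 g R H) blk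
        (mulOp (hs i ∘ Prod.fst) *
            levelSum (fun l : Fin (k + 1) => towerBlk Ks (l : ℕ)) W (fun l => towerTr Ks Rm (l : ℕ)) a -
          levelSum (fun l : Fin (k + 1) => towerBlk Ks (l : ℕ)) W (fun l => towerTr Ks Rm (l : ℕ)) a *
            mulOp (hs i ∘ Prod.fst))
        (fun b y' : g.Site => if b = y' then
          ∑ l : Fin (k + 1), |a l| * (if b ∈ S' i then 2 * (∑ j ∈ Finset.range l, D j : ℕ) * θ else 0) *
            (wb l ^ 2 * (Fintype.card Cp : ℝ) ^ 2 * towerN n l) else 0))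
    ∧ (∀ i (b y' : g.Site), 0 ≤ (if b = y' then
          ∑ l : Fin (k + 1), |a l| * (if b ∈ S' i then 2 * (∑ j ∈ Finset.range l, D j : ℕ) * θ else 0) *
            (wb l ^ 2 * (Fintype.card Cp : ℝ) ^ 2 * towerN n l) else 0))
    ∧ (∀ i (b y' : g.Site), (if b = y' then
          ∑ l : Fin (k + 1), |a l| * (if b ∈ S' i then 2 * (∑ j ∈ Finset.range l, D j : ℕ) * θ else 0) *
            (wb l ^ 2 * (Fintype.card Cp : ℝ) ^ 2 * towerN n l) else 0) ≠ 0 → g.dist b y' ≤ ρ)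
    ∧ (∀ i (b : g.Site), ∑ y' : g.Site, (if b = y' then
          ∑ l : Fin (k + 1), |a l| * (if b ∈ S' i then 2 * (∑ j ∈ Finset.range l, D j : ℕ) * θ else 0) *
            (wb l ^ 2 * (Fintype.card Cp : ℝ) ^ 2 * towerN n l) else 0) * g.len y' ^ 2
          ≤ if b ∈ S' i then ∑ l : Fin (k + 1), (2 * (∑ j ∈ Finset.range l, D j : ℕ) * θ) * kk l else 0)
    ∧ (∀ i (y' : g.Site), (∑ b : g.Site, (if b = y' then
          ∑ l : Fin (k + 1), |a l| * (if b ∈ S' i then 2 * (∑ j ∈ Finset.range l, D j : ℕ) * θ else 0) *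
            (wb l ^ 2 * (Fintype.card Cp : ℝ) ^ 2 * towerN n l) else 0)) * g.len y' ^ 2
          ≤ if y' ∈ S' i then ∑ l : Fin (k + 1), (2 * (∑ j ∈ Finset.range l, D j : ℕ) * θ) * kk l else 0) := by
  have hP0 : ∀ l : Fin (k + 1), 0 ≤ 2 * ((∑ j ∈ Finset.range l, D j : ℕ) : ℝ) * θ := fun l => by positivity
  refine commData_towerLevelSum Ks Rm hRm k W a wb n blk hnestTop hW hn ρ hρ kk
    (fun l => 2 * (∑ j ∈ Finset.range l, D j : ℕ) * θ) hk hs S'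
    (fun i l b => if b ∈ S' i then 2 * (∑ j ∈ Finset.range l, D j : ℕ) * θ else 0)
    (fun i l b => by split_ifs <;> [exact hP0 l; exact le_rfl])
    (fun i l b => by split_ifs <;> [exact le_rfl; exact hP0 l])
    (fun i l b hne => by by_contra hb; exact hne (if_neg hb)) ?_
  intro i l p q hpq
  by_cases hS : blk p ∈ S' i
  · rw [if_pos hS]
    exact tower_osc_of_bondBound Ks hD hθ0 (hθ i) l hpq.symm
  · rw [if_neg hS]
    have hq : blk q ∉ S' i := by rwa [hnestTop p q (towerBlk_eq_of_le Ks (Nat.le_of_lt_succ l.isLt) hpq)]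
    rw [hzero i p hS, hzero i q hq, sub_self, abs_zero]

end TowerBond

/-! ## §7  On the torus with the partition of unity of [3] (1.118): the oscillation letter is 2(Σ_{j<l} d(M_j − 1))·4d∕M₀ -/

section Torus

variable {d : ℕ} {N : Fin d → ℕ} [∀ i, NeZero (N i)] [NeZero d]

/-- **THE «O(M⁻¹)» OF THE AVERAGING LINE ON THE TORUS TOWER, EXPLICIT**: for the tower of cube combs of sides `M_j`
(`B9Thm37GlueTorusCovTower.torusTower`) and the partition of unity `h_z = hSU N M₀ z` of [3] (1.118) (per-bond differences
`≤ 4d∕M₀`, `B9Thm37GluePU.hθ_torus`), two sites of one level-`l` tower block satisfy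
`|h_z(x) − h_z(x′)| ≤ 2·(Σ_{j<l} d(M_j − 1))·(4d∕M₀)`. [cite: Balaban1985BackgroundPropagators, (3.89) p.409; Balaban1984PropagatorsI, (1.118) p.36] -/
theorem torusTower_osc_hSU {M : ℕ → ℕ} (hM : ∀ j, 1 ≤ M j) (hdiv : ∀ j i, M j ∣ N i) {M₀ : ℕ} (hM₀ : 1 ≤ M₀)
    (z : B5TorusCover.Ctr N M₀) (l : ℕ) {x x' : B5TorusCover.UT N}
    (hb : towerBlk (B9Thm37GlueTorusCovTower.torusTower hM hdiv) l x =
      towerBlk (B9Thm37GlueTorusCovTower.torusTower hM hdiv) l x') :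
    |B5SmoothPartition.hSU N M₀ z x - B5SmoothPartition.hSU N M₀ z x'| ≤
      2 * (∑ j ∈ Finset.range l, d * (M j - 1) : ℕ) * (4 * d / (M₀ : ℝ)) := by
  have hθ0 : (0 : ℝ) ≤ 4 * d / (M₀ : ℝ) := by positivity
  refine tower_osc_of_bondBound (B9Thm37GlueTorusCovTower.torusTower hM hdiv) (D := fun j => d * (M j - 1))
    (fun j y => B9Thm37GlueTorusCovPoinc.tdepth_le (hM j) y) hθ0 (fun b => ?_) l hb
  have h := B9Thm37GluePU.hθ_torus (N := N) hM₀ (1 : ℝ) z b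
  simpa only [one_mul, abs_one] using h

end Torus


/-! ## §8 (v1.1, append-only)  The five Q-binders ON THE TORUS with every letter explicit (consumer form for `thm37_left`∕`h389`) -/

section TorusData

variable {d : ℕ} {N : Fin d → ℕ} [∀ i, NeZero (N i)] [NeZero d] {g : B9.Geometry} [Fintype g.Site] [DecidableEq g.Site]
  {R : ℝ} {H : Prop} {Cp : Type} [Fintype Cp] [DecidableEq Cp]

/-- **THE Q-DATA OF THE LINEAGE FOR THE TORUS TOWER'S AVERAGING PART, ALL LETTERS EXPLICIT** (v1.1): on the torus `UT N` with the
cube-comb tower of sides `M_j` (`torusTower`), isometric bond matrices `Rm`, block weights `|W_l| ≤ wb_l`, coefficients `a_l`, the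
partition of unity `h_z = hSU N M₀ z` of [3] (1.118) and a geometry blocking `blk` through which the top level factors, with `h_z ≠ 0`
only on blocks of `S′_z`: the five binders `hQ hKQ hlocQ hrowQ hcolQ` of `B9Thm37GlueSz`∕`B9Thm37GluePU`∕`B9Thm37Glue.h389_of_342` hold
for `Qf := Σ_{l≤k} a_lG_lᵀG_l` with the block-diagonal kernel of `commData_towerLevelSum_of_bondBound` at θ = 4d∕M₀, D_j = d(M_j − 1),
n_j = M_j^d, i.e. ω_l = 2(Σ_{j<l} d(M_j − 1))·4d∕M₀ and κ_Q = Σ_l ω_l·k_l — print's «O(M⁻¹)» of (3.89), in the model's letters.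
[cite: Balaban1985BackgroundPropagators, (3.88)–(3.89) p.409 + (3.16)∕(3.19) p.393; Balaban1984PropagatorsI, (1.118) p.36] -/
theorem commData_torusTower_hSU {M : ℕ → ℕ} (hMj : ∀ j, 1 ≤ M j) (hdivj : ∀ j i, M j ∣ N i) {M₀ : ℕ} (hM₀ : 1 ≤ M₀)
    (Rm : B5TorusCover.UT N × Fin d → Cp → Cp → ℝ)
    (hRm : ∀ b i j, ∑ k, Rm b k i * Rm b k j = if i = j then (1 : ℝ) else 0)
    (k : ℕ) (W : Fin (k + 1) → B5TorusCover.UT N → ℝ) (a : Fin (k + 1) → ℝ) (wb : Fin (k + 1) → ℝ)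
    (blk : B5TorusCover.UT N × Cp → g.Site)
    (hnestTop : ∀ p q : B5TorusCover.UT N × Cp,
      towerBlk (B9Thm37GlueTorusCovTower.torusTower hMj hdivj) k q.1 =
        towerBlk (B9Thm37GlueTorusCovTower.torusTower hMj hdivj) k p.1 → blk q = blk p)
    (hW : ∀ l x, |W l x| ≤ wb l) (ρ : ℝ) (hρ : ∀ b : g.Site, g.dist b b ≤ ρ) (kk : Fin (k + 1) → ℝ)
    (hk : ∀ l (b : g.Site),
      |a l| * (wb l ^ 2 * (Fintype.card Cp : ℝ) ^ 2 * towerN (fun j => M j ^ d) l) * g.len b ^ 2 ≤ kk l)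
    (S' : B5TorusCover.Ctr N M₀ → Finset g.Site)
    (hS' : ∀ z (p : B5TorusCover.UT N × Cp), B5SmoothPartition.hSU N M₀ z p.1 ≠ 0 → blk p ∈ S' z) :
    (∀ z, HasMajorant (g := toB6 g R H) blk
        (mulOp (B5SmoothPartition.hSU N M₀ z ∘ Prod.fst) *
            levelSum (fun l : Fin (k + 1) => towerBlk (B9Thm37GlueTorusCovTower.torusTower hMj hdivj) (l : ℕ)) W
              (fun l => towerTr (B9Thm37GlueTorusCovTower.torusTower hMj hdivj) Rm (l : ℕ)) a -
          levelSum (fun l : Fin (k + 1) => towerBlk (B9Thm37GlueTorusCovTower.torusTower hMj hdivj) (l : ℕ)) W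
              (fun l => towerTr (B9Thm37GlueTorusCovTower.torusTower hMj hdivj) Rm (l : ℕ)) a *
            mulOp (B5SmoothPartition.hSU N M₀ z ∘ Prod.fst))
        (fun b y' : g.Site => if b = y' then
          ∑ l : Fin (k + 1), |a l| *
            (if b ∈ S' z then 2 * (∑ j ∈ Finset.range l, d * (M j - 1) : ℕ) * (4 * d / (M₀ : ℝ)) else 0) *
            (wb l ^ 2 * (Fintype.card Cp : ℝ) ^ 2 * towerN (fun j => M j ^ d) l) else 0))
    ∧ (∀ z (b y' : g.Site), 0 ≤ (if b = y' then
          ∑ l : Fin (k + 1), |a l| *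
            (if b ∈ S' z then 2 * (∑ j ∈ Finset.range l, d * (M j - 1) : ℕ) * (4 * d / (M₀ : ℝ)) else 0) *
            (wb l ^ 2 * (Fintype.card Cp : ℝ) ^ 2 * towerN (fun j => M j ^ d) l) else 0))
    ∧ (∀ z (b y' : g.Site), (if b = y' then
          ∑ l : Fin (k + 1), |a l| *
            (if b ∈ S' z then 2 * (∑ j ∈ Finset.range l, d * (M j - 1) : ℕ) * (4 * d / (M₀ : ℝ)) else 0) *
            (wb l ^ 2 * (Fintype.card Cp : ℝ) ^ 2 * towerN (fun j => M j ^ d) l) else 0) ≠ 0 → g.dist b y' ≤ ρ)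
    ∧ (∀ z (b : g.Site), ∑ y' : g.Site, (if b = y' then
          ∑ l : Fin (k + 1), |a l| *
            (if b ∈ S' z then 2 * (∑ j ∈ Finset.range l, d * (M j - 1) : ℕ) * (4 * d / (M₀ : ℝ)) else 0) *
            (wb l ^ 2 * (Fintype.card Cp : ℝ) ^ 2 * towerN (fun j => M j ^ d) l) else 0) * g.len y' ^ 2
          ≤ if b ∈ S' z then
            ∑ l : Fin (k + 1), (2 * (∑ j ∈ Finset.range l, d * (M j - 1) : ℕ) * (4 * d / (M₀ : ℝ))) * kk l else 0)
    ∧ (∀ z (y' : g.Site), (∑ b : g.Site, (if b = y' then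
          ∑ l : Fin (k + 1), |a l| *
            (if b ∈ S' z then 2 * (∑ j ∈ Finset.range l, d * (M j - 1) : ℕ) * (4 * d / (M₀ : ℝ)) else 0) *
            (wb l ^ 2 * (Fintype.card Cp : ℝ) ^ 2 * towerN (fun j => M j ^ d) l) else 0)) * g.len y' ^ 2
          ≤ if y' ∈ S' z then
            ∑ l : Fin (k + 1), (2 * (∑ j ∈ Finset.range l, d * (M j - 1) : ℕ) * (4 * d / (M₀ : ℝ))) * kk l else 0) := by
  have hθ0 : (0 : ℝ) ≤ 4 * d / (M₀ : ℝ) := by positivity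
  have hθ : ∀ (z : B5TorusCover.Ctr N M₀) (b : B5TorusCover.UT N × Fin d),
      |B5SmoothPartition.hSU N M₀ z (B9Thm37GluePU.btgt b) - B5SmoothPartition.hSU N M₀ z (B9Thm37GluePU.bsrc b)| ≤
        4 * d / (M₀ : ℝ) :=
    fun z b => by simpa only [one_mul, abs_one] using B9Thm37GluePU.hθ_torus (N := N) hM₀ (1 : ℝ) z b
  have hzero : ∀ (z : B5TorusCover.Ctr N M₀) (p : B5TorusCover.UT N × Cp), blk p ∉ S' z →
      B5SmoothPartition.hSU N M₀ z p.1 = 0 := fun z p hp => by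
    by_contra hne
    exact hp (hS' z p hne)
  exact commData_towerLevelSum_of_bondBound (B9Thm37GlueTorusCovTower.torusTower hMj hdivj) Rm hRm k W a wb
    (fun j => M j ^ d) (fun j => d * (M j - 1)) blk hnestTop hW
    (fun j z => B9Thm37GlueTorusCovPoinc.card_block_le (hMj j) (hdivj j) z)
    (fun j y => B9Thm37GlueTorusCovPoinc.tdepth_le (hMj j) y) ρ hρ kk hk (B5SmoothPartition.hSU N M₀) S' hθ0 hθ hzero

end TorusData

end

end Literature.MathematicalPhysics.QuantumFieldTheory.Balaban1983to89.B9Thm37GlueLevelSumOsc
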